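import Summits.ResolutionOfSingularities.ResolutionOfSingularities.Theorems.UltraWalkField
import Summits.ResolutionOfSingularities.ResolutionOfSingularities.Theorems.UniformWalkKernels
import Literature.AlgebraicGeometry.Resolution.HasseSchmidtDiffEqDiffOp
import Literature.AlgebraicGeometry.Resolution.HasseSchmidtDiffEqDiffOp
import HarnessLib

/-!
# UltraWalkPoly — base change of the point-blow-up model along ring homomorphisms, and Łoś for polynomials

NODE «UltraWalk» (decomp-res lens-3, gen 30), file 2/4.  Two elementary layers under the transfer law:

* §1 the model operations of `Literature…PointBlowup` — `chartTransform`, `translate`, Hauser's `deletePthPowers`, the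
  Hasse–Schmidt derivatives `hasseDeriv` — COMMUTE with `MvPolynomial.map φ` for every ring homomorphism `φ` (the residual
  polynomial of `step` is a coefficient-polynomial expression of the data);
* §2 polynomials over a PRODUCT ring `Π B, K B`: a family `G B ∈ K_B[u]` with supports inside one finite set `M` is the
  family of components of ONE polynomial `liftPoly M G` (`map_eval_liftPoly`); §3 two polynomials over the product whose
  components agree on a set of the ultrafilter have the same image over the ultraproduct (`map_mk_eq_of_eventually`) —
  Łoś for coefficient identities —, the order `ord₀` is bounded below levelwise (`natCast_le_ordZero_map_mk`), and the box
  `box σ D` of exponents of degree `≤ D` carries the uniform support bounds.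

No `sorry`, standard axioms. (Sources: Hauser2010 §F (chart formulas); Marker2002 Ex. 2.5.19.) [folklore]
-/

noncomputable section

open MvPolynomial
open Literature.AlgebraicGeometry.Resolution
open Literature.AlgebraicGeometry.Resolution.Hauser2010
open Literature.AlgebraicGeometry.Resolution.PointBlowup

namespace Summit.ResolutionOfSingularities.ResolutionOfSingularities.Theorems.UltraWalk

/-! ## §1 The model operations commute with base change along a ring homomorphism -/

section BaseChange

variable {σ : Type} [DecidableEq σ] {K L : Type} [CommRing K] [CommRing L] (φ : K →+* L)

/-- `chartTransform` commutes with `map φ`. [folklore] -/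
theorem map_chartTransform (q : ℕ) (j : σ) (F : MvPolynomial σ K) :
    map φ (chartTransform q j F) = chartTransform q j (map φ F) := by
  unfold chartTransform
  rw [map_sum]
  simp only [map_monomial]
  symm
  refine Finset.sum_subset (support_map_subset φ F) fun d _ hd => ?_
  have : φ (coeff d F) = 0 := by rw [← coeff_map]; exact notMem_support_iff.mp hd
  rw [coeff_map, ← coeff_map φ, show coeff d (map φ F) = φ (coeff d F) from coeff_map φ F d, this, monomial_zero]

omit [DecidableEq σ] in
/-- `translate` commutes with `map φ` (the point is pushed along `φ`). [folklore] -/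
theorem map_translate (b : σ → K) (G : MvPolynomial σ K) :
    map φ (PointBlowup.translate b G) = PointBlowup.translate (fun i => φ (b i)) (map φ G) := by
  unfold PointBlowup.translate
  have h : (fun i => map φ (X i + C (b i))) = fun i => (X i + C (φ (b i)) : MvPolynomial σ L) := by
    funext i; simp
  rw [aeval_eq_bind₁, aeval_eq_bind₁, map_bind₁, h]

/-- `deletePthPowers` commutes with `map φ`. [folklore] -/
theorem map_deletePthPowers (q : ℕ) (F : MvPolynomial σ K) :
    map φ (deletePthPowers q F) = deletePthPowers q (map φ F) := by
  ext d
  rw [coeff_map, coeff_deletePthPowers, coeff_deletePthPowers, coeff_map]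
  split_ifs <;> simp

/-- The Hasse–Schmidt derivatives commute with `map φ`. [folklore] -/
theorem map_hasseDeriv (a : σ →₀ ℕ) (F : MvPolynomial σ K) :
    map φ (hasseDeriv K a F) = hasseDeriv L a (map φ F) := by
  induction F using MvPolynomial.induction_on' with
  | monomial d c =>
    rw [hasseDeriv_monomial, map_monomial, hasseDeriv_monomial, map_mul, map_monomial, map_natCast]
  | add P Q hP hQ => rw [map_add, map_add, map_add, hP, hQ, map_add]

/-- The residual polynomial of the tree's `step` (its `F`-component) is `deletePthPowers ∘ translate ∘ chartTransform`
— by definition; recorded to decouple the walk axioms from the multiplicity component `r`. [folklore] -/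
theorem step_F [DecidableEq K] (q : ℕ) (j : σ) (b : σ → K) (s : State σ K) :
    (step q j b s).F = deletePthPowers q (PointBlowup.translate b (chartTransform q j s.F)) := rfl

/-- **The walk axioms never read the multiplicity component `r`**: the point transform (hence `IsEquimultiplePoint`)
and the residual polynomial of `step` (hence `IsolatedTop` at the next state) depend on the state only through `F` — so
the transfer recomputes `r` upstairs instead of transferring it. [folklore] -/
theorem pointTransform_step_F_of_F [DecidableEq K] (q : ℕ) (j : σ) (b : σ → K) (s : State σ K) (r' : σ →₀ ℕ) :
    pointTransform q j b s = pointTransform q j b ⟨s.F, r'⟩ ∧ (step q j b s).F = (step q j b ⟨s.F, r'⟩).F :=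
  ⟨rfl, rfl⟩

/-- Hence the `F`-component of `step` commutes with base change (for ANY multiplicity vector upstairs). [folklore] -/
theorem map_step_F [DecidableEq K] [DecidableEq L] (q : ℕ) (j : σ) (b : σ → K) (s : State σ K) (r' : σ →₀ ℕ) :
    map φ (step q j b s).F = (step q j (fun i => φ (b i)) (⟨map φ s.F, r'⟩ : State σ L)).F := by
  rw [step_F, step_F, map_deletePthPowers, map_translate, map_chartTransform]

omit [DecidableEq σ] in
omit [DecidableEq σ] in
/-- `ord₀ F ≥ n` is the vanishing of the coefficients of degree `< n`. [folklore] -/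
theorem natCast_le_ordZero_iff (n : ℕ) (F : MvPolynomial σ K) :
    ((n : ℕ) : ℕ∞) ≤ ordZero F ↔ ∀ d : σ →₀ ℕ, d.degree < n → coeff d F = 0 := by
  refine ⟨fun h d hd => ?_, fun h => ?_⟩
  · have := MvPowerSeries.coeff_of_lt_order (f := (F : MvPowerSeries σ K)) (d := d)
      (lt_of_lt_of_le (by exact_mod_cast hd) h)
    simpa [MvPolynomial.coeff_coe] using this
  · exact MvPowerSeries.nat_le_order fun d hd => by simpa [MvPolynomial.coeff_coe] using h d hd

end BaseChange

/-! ## §2 Polynomials over a product of rings: lifting families of uniformly bounded support -/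

section Product

/-- The BOX of exponents all of whose entries are `≤ D` (it contains every exponent of degree `≤ D`).
DEFINITION (support). [folklore] -/
def box (σ : Type) [DecidableEq σ] [Fintype σ] (D : ℕ) : Finset (σ →₀ ℕ) :=
  (Finset.univ : Finset (σ → Fin (D + 1))).image fun v => Finsupp.equivFunOnFinite.symm fun i => (v i : ℕ)

variable {σ : Type} [DecidableEq σ] {K : ℕ → Type} [∀ B, CommRing (K B)]

/-- An exponent of degree `≤ D` lies in the box. [folklore] -/
theorem mem_box_of_degree_le [Fintype σ] {D : ℕ} {m : σ →₀ ℕ} (hm : m.degree ≤ D) : m ∈ box σ D := by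
  rw [box, Finset.mem_image]
  have hle : ∀ i, m i ≤ D := fun i => by
    by_cases hi : i ∈ m.support
    · exact le_trans (Finset.single_le_sum (fun j _ => Nat.zero_le (m j)) hi) hm
    · rw [Finsupp.notMem_support_iff.mp hi]; exact Nat.zero_le D
  refine ⟨fun i => ⟨m i, Nat.lt_succ_of_le (hle i)⟩, Finset.mem_univ _, ?_⟩
  ext i; simp

omit [DecidableEq σ] in
/-- The degree of an exponent of the support is at most the total degree. [folklore] -/
theorem degree_le_totalDegree_of_mem_support {R : Type} [CommSemiring R] {F : MvPolynomial σ R} {m : σ →₀ ℕ} (hm : m ∈ F.support) :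
    m.degree ≤ F.totalDegree := by
  rw [Finsupp.degree_apply]
  exact le_totalDegree hm

/-- The DEGREE BOX: the exponents of degree `≤ D` (a finite set). DEFINITION (support). [folklore] -/
def dbox (σ : Type) [DecidableEq σ] [Fintype σ] (D : ℕ) : Finset (σ →₀ ℕ) := (box σ D).filter fun m => m.degree ≤ D

/-- Membership in the degree box is `degree ≤ D`. [folklore] -/
theorem mem_dbox_iff [Fintype σ] {D : ℕ} {m : σ →₀ ℕ} : m ∈ dbox σ D ↔ m.degree ≤ D := by
  rw [dbox, Finset.mem_filter]
  exact ⟨fun h => h.2, fun h => ⟨mem_box_of_degree_le h, h⟩⟩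

/-- The support of a polynomial of total degree `≤ D` lies in the degree box. [folklore] -/
theorem support_subset_dbox [Fintype σ] {R : Type} [CommSemiring R] {D : ℕ} {F : MvPolynomial σ R}
    (hF : F.totalDegree ≤ D) : F.support ⊆ dbox σ D := fun _ hm =>
  mem_dbox_iff.mpr (le_trans (degree_le_totalDegree_of_mem_support hm) hF)

/-- Conversely a polynomial with support in the degree box has total degree `≤ D`. [folklore] -/
theorem totalDegree_le_of_support_subset_dbox [Fintype σ] {R : Type} [CommSemiring R] {D : ℕ} {F : MvPolynomial σ R}
    (hF : F.support ⊆ dbox σ D) : F.totalDegree ≤ D := by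
  rw [totalDegree]
  refine Finset.sup_le fun m hm => ?_
  have h := mem_dbox_iff.mp (hF hm)
  rwa [Finsupp.degree_apply] at h

/-- LIFT of a family of polynomials with supports inside `M` to ONE polynomial over the product ring.
DEFINITION (support). [folklore] -/
def liftPoly (M : Finset (σ →₀ ℕ)) (G : ∀ B, MvPolynomial σ (K B)) : MvPolynomial σ (∀ B, K B) :=
  ∑ m ∈ M, monomial m fun B => coeff m (G B)

/-- Coefficients of the lift. [folklore] -/
theorem coeff_liftPoly (M : Finset (σ →₀ ℕ)) (G : ∀ B, MvPolynomial σ (K B)) (m : σ →₀ ℕ) :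
    coeff m (liftPoly M G) = if m ∈ M then (fun B => coeff m (G B)) else 0 := by
  unfold liftPoly
  rw [coeff_sum]
  simp only [coeff_monomial]
  rw [Finset.sum_ite_eq']

/-- The `B`-th component of the lift is `G B` (support inside `M`). [folklore] -/
theorem map_eval_liftPoly {M : Finset (σ →₀ ℕ)} {G : ∀ B, MvPolynomial σ (K B)} (B : ℕ) (hG : (G B).support ⊆ M) :
    map (Pi.evalRingHom K B) (liftPoly M G) = G B := by
  ext m
  rw [coeff_map, coeff_liftPoly]
  split_ifs with hm
  · rfl
  · simp only [map_zero]
    exact (notMem_support_iff.mp fun h => hm (hG h)).symm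

/-- The support of the lift lies inside `M`. [folklore] -/
theorem support_liftPoly_subset (M : Finset (σ →₀ ℕ)) (G : ∀ B, MvPolynomial σ (K B)) : (liftPoly M G).support ⊆ M := by
  intro m hm
  by_contra h
  exact (mem_support_iff.mp hm) (by rw [coeff_liftPoly, if_neg h])

end Product

/-! ## §3 Łoś for coefficient identities over the ultraproduct -/

section Los

variable {σ : Type} {K : ℕ → Type} [∀ B, Field (K B)] {U : Ultrafilter ℕ}

/-- Two polynomials over the product whose components agree `U`-almost everywhere have the SAME image over the
ultraproduct. [folklore] -/
theorem map_mk_eq_of_eventually {P Q : MvPolynomial σ (∀ B, K B)}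
    (h : ∀ᶠ B in (U : Filter ℕ), map (Pi.evalRingHom K B) P = map (Pi.evalRingHom K B) Q) :
    map (Ultra.mk K U) P = map (Ultra.mk K U) Q := by
  ext m
  rw [coeff_map, coeff_map, Ultra.mk_eq_mk_iff]
  filter_upwards [h] with B hB
  have := congrArg (coeff m) hB
  rwa [coeff_map, coeff_map] at this

/-- A coefficient of the image over the ultraproduct VANISHES iff it vanishes levelwise `U`-a.e. [folklore] -/
theorem coeff_map_mk_eq_zero_iff {P : MvPolynomial σ (∀ B, K B)} {m : σ →₀ ℕ} :
    coeff m (map (Ultra.mk K U) P) = 0 ↔ ∀ᶠ B in (U : Filter ℕ), coeff m (map (Pi.evalRingHom K B) P) = 0 := by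
  rw [coeff_map, Ultra.mk_eq_zero_iff]
  exact Filter.eventually_congr (Filter.Eventually.of_forall fun B => by rw [coeff_map]; rfl)

/-- … and is NON-ZERO iff it is non-zero levelwise `U`-a.e. (ultra). [folklore] -/
theorem coeff_map_mk_ne_zero_iff {P : MvPolynomial σ (∀ B, K B)} {m : σ →₀ ℕ} :
    coeff m (map (Ultra.mk K U) P) ≠ 0 ↔ ∀ᶠ B in (U : Filter ℕ), coeff m (map (Pi.evalRingHom K B) P) ≠ 0 := by
  rw [Ne, coeff_map_mk_eq_zero_iff, Ultrafilter.eventually_not]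

/-- The order at the origin is bounded below by a levelwise bound. [folklore] -/
theorem natCast_le_ordZero_map_mk {P : MvPolynomial σ (∀ B, K B)} {n : ℕ}
    (h : ∀ᶠ B in (U : Filter ℕ), ((n : ℕ) : ℕ∞) ≤ ordZero (map (Pi.evalRingHom K B) P)) :
    ((n : ℕ) : ℕ∞) ≤ ordZero (map (Ultra.mk K U) P) := by
  rw [natCast_le_ordZero_iff]
  intro d hd
  rw [coeff_map_mk_eq_zero_iff]
  filter_upwards [h] with B hB
  exact (natCast_le_ordZero_iff n _).mp hB d hd

/-- The image along any ring homomorphism of a polynomial with support in the degree box has total degree `≤ D`. [folklore] -/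
theorem totalDegree_map_le_of_support_subset_dbox [DecidableEq σ] [Fintype σ] {R S : Type} [CommSemiring R] [CommSemiring S]
    (ψ : R →+* S) {P : MvPolynomial σ R} {D : ℕ} (hP : P.support ⊆ dbox σ D) : (map ψ P).totalDegree ≤ D :=
  totalDegree_le_of_support_subset_dbox ((support_map_subset ψ P).trans hP)

end Los

end Summit.ResolutionOfSingularities.ResolutionOfSingularities.Theorems.UltraWalk
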